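import Summits.CriticalPhenomena.PercolationContinuityZ3.Theorems.PercNearOneGluingNoHeavyLowerTailCILSetStarTools
import Literature.Probability.LatticeModels.ProdBernoulliIndependence
import HarnessLib

/-!
# `NoHeavyLowerTail` (stmt-CriticalPhenomena-4575) — the GATE (flat star) EXPANSION of the separated margin of a two-port star family

Support file (prover `prim-gen-swap` gen 7; `--supports stmt-CriticalPhenomena-4575`).  No definitions, no named facts, no sorries.

Setting (seat memo R3-SEATS.md §7, blueprint `setCS_twoPortStars_levelTwo`): `m` star centres `s i` (pairwise distinct, off `A`), ports
`p i ≠ p' i` (all `2m` ports pairwise distinct, never a star centre), port pairs of weights `β_i = w(s(s i,p i))`, `β_i' = w(s(s i,p' i))`,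
no other positive pair at a star; `S = {s i}`; `ξ(ω) = ω ∩ {e | ∀ v ∈ S, v ∉ e}`; for a joint state `t : Fin m → Bool × Bool` the PORT SET
`Y(t) = {p i : (t i).1} ∪ {p' i : (t i).2}` and the state probability `ι(t) = Π_i (β_i | 1−β_i)·(β_i' | 1−β_i')`.

* `StarSet.gateSet_eq_portSet` (pointwise) — off the junk pairs, the gate set `Γ(ω)` of `S` (prim-gen-induct's `…CILSetStarTools`) is the
  port set of the state read off `ω`.
* `StarSet.portSet_injective` — distinct ports: the state is determined by its port set.
* `StarSet.real_gateSet_eq_stateWeight` — `μ_w{Γ = Y(t)} = ι(t)` (independence of the `2m` port pairs).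
* `StarSet.setCSdiff_gate_expansion` — **step (1) of the level-two observer-set theorem, for any number of stars**:
  `μ_w(c ↮ S, |π(c)| ≤ j) − μ_w(c ↮ S, 1 ≤ |π(S)| ≤ j) = Σ_t ι(t)·[μ_w(c ↮' Y(t), |π'(c)| ≤ j) − μ_w(c ↮' Y(t), 1 ≤ |π'(Y(t))| ≤ j)]`,
  primes read on `ξ(ω)` — the flat expansion `CutObserver.SetStar.setL_eq_sum` / `setR_eq_sum` over the family of port sets, reindexed by
  the states (`m = 2, 3`: `Hyperedge.pairCSdiff_double_star_expansion`, `Hyperedge.tripleCSdiff_star_expansion`).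
-/

noncomputable section

namespace Summit.CriticalPhenomena.PercolationContinuityZ3.Theorems

open MeasureTheory Set Literature.Probability.LatticeModels Literature.Probability.Percolation
open scoped Classical BigOperators

variable {n m : ℕ}

namespace StarSet

/-- **Gate set = port set of the state (pointwise).**  If the pairs open at the star centres are port pairs only and `t` records which
port pairs are open, the gate set of `S = {s i}` is `Y(t)`. [folklore] -/
theorem gateSet_eq_portSet (ω : BondConfig (Fin n)) (s p p' : Fin m → Fin n) (t : Fin m → Bool × Bool)
    (hps : ∀ i k, p i ≠ s k) (hp's : ∀ i k, p' i ≠ s k)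
    (hjunk : ∀ i u, u ≠ s i → s(s i, u) ∈ ω → u = p i ∨ u = p' i)
    (ht : ∀ i, ((t i).1 = true ↔ s(s i, p i) ∈ ω) ∧ ((t i).2 = true ↔ s(s i, p' i) ∈ ω)) :
    (Finset.univ.filter fun u => u ∉ Finset.univ.image s ∧ ∃ v ∈ Finset.univ.image s, s(u, v) ∈ ω) =
      (Finset.univ.filter fun i => (t i).1 = true).image p ∪ (Finset.univ.filter fun i => (t i).2 = true).image p' := by
  ext u
  simp only [Finset.mem_filter, Finset.mem_univ, true_and, Finset.mem_union, Finset.mem_image]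
  constructor
  · rintro ⟨huS, v, ⟨i, rfl⟩, huv⟩
    have hne : u ≠ s i := fun h => huS ⟨i, h.symm⟩
    have huv' : s(s i, u) ∈ ω := by rw [Sym2.eq_swap]; exact huv
    rcases hjunk i u hne huv' with rfl | rfl
    · exact Or.inl ⟨i, (ht i).1.2 huv', rfl⟩
    · exact Or.inr ⟨i, (ht i).2.2 huv', rfl⟩
  · rintro (⟨i, hi, rfl⟩ | ⟨i, hi, rfl⟩)
    · refine ⟨?_, s i, ⟨i, rfl⟩, ?_⟩
      · rintro ⟨k, hk⟩; exact hps i k hk.symm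
      · rw [Sym2.eq_swap]; exact (ht i).1.1 hi
    · refine ⟨?_, s i, ⟨i, rfl⟩, ?_⟩
      · rintro ⟨k, hk⟩; exact hp's i k hk.symm
      · rw [Sym2.eq_swap]; exact (ht i).2.1 hi

/-- Membership of a port in the port set of a state (distinct ports). [folklore] -/
theorem mem_portSet_iff (p p' : Fin m → Fin n) (t : Fin m → Bool × Bool) (hpp' : ∀ i, p i ≠ p' i)
    (hdis : ∀ i k, i ≠ k → p i ≠ p k ∧ p i ≠ p' k ∧ p' i ≠ p' k) (i : Fin m) :
    (p i ∈ (Finset.univ.filter fun i => (t i).1 = true).image p ∪ (Finset.univ.filter fun i => (t i).2 = true).image p' ↔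
        (t i).1 = true) ∧
      (p' i ∈ (Finset.univ.filter fun i => (t i).1 = true).image p ∪ (Finset.univ.filter fun i => (t i).2 = true).image p' ↔
        (t i).2 = true) := by
  simp only [Finset.mem_union, Finset.mem_image, Finset.mem_filter, Finset.mem_univ, true_and]
  constructor
  · constructor
    · rintro (⟨k, hk, hki⟩ | ⟨k, hk, hki⟩)
      · by_cases h : k = i
        · exact h ▸ hk
        · exact absurd hki (hdis k i h).1
      · by_cases h : k = i
        · subst h; exact absurd hki.symm (hpp' k)
        · exact absurd hki.symm (hdis i k (Ne.symm h)).2.1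
    · exact fun h => Or.inl ⟨i, h, rfl⟩
  · constructor
    · rintro (⟨k, hk, hki⟩ | ⟨k, hk, hki⟩)
      · by_cases h : k = i
        · subst h; exact absurd hki (hpp' k)
        · exact absurd hki (hdis k i h).2.1
      · by_cases h : k = i
        · exact h ▸ hk
        · exact absurd hki (hdis k i h).2.2
    · exact fun h => Or.inr ⟨i, h, rfl⟩

/-- **Distinct ports: the state is determined by its port set.** [folklore] -/
theorem portSet_injective (p p' : Fin m → Fin n) (hpp' : ∀ i, p i ≠ p' i)
    (hdis : ∀ i k, i ≠ k → p i ≠ p k ∧ p i ≠ p' k ∧ p' i ≠ p' k) (t t' : Fin m → Bool × Bool)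
    (h : (Finset.univ.filter fun i => (t i).1 = true).image p ∪ (Finset.univ.filter fun i => (t i).2 = true).image p' =
      (Finset.univ.filter fun i => (t' i).1 = true).image p ∪ (Finset.univ.filter fun i => (t' i).2 = true).image p') :
    t = t' := by
  funext i
  have h1 := mem_portSet_iff p p' t hpp' hdis i
  have h2 := mem_portSet_iff p p' t' hpp' hdis i
  rw [h] at h1
  refine Prod.ext ?_ ?_
  · rw [Bool.eq_iff_iff, ← h1.1, h2.1]
  · rw [Bool.eq_iff_iff, ← h1.2, h2.2]

/-- **Probability of a gate class = state weight.**  `μ_w{Γ = Y(t)} = Π_i (β_i | 1−β_i)·(β_i' | 1−β_i')`. [folklore] -/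
theorem real_gateSet_eq_stateWeight (w : Sym2 (Fin n) → unitInterval) (s p p' : Fin m → Fin n) (t : Fin m → Bool × Bool)
    (hs : Function.Injective s) (hps : ∀ i k, p i ≠ s k) (hp's : ∀ i k, p' i ≠ s k) (hpp' : ∀ i, p i ≠ p' i)
    (hdis : ∀ i k, i ≠ k → p i ≠ p k ∧ p i ≠ p' k ∧ p' i ≠ p' k)
    (hwjunk : ∀ i u, u ≠ s i → u ≠ p i → u ≠ p' i → w s(s i, u) = 0) :
    (prodBernoulli w).real {ω : BondConfig (Fin n) |
        (Finset.univ.filter fun u => u ∉ Finset.univ.image s ∧ ∃ v ∈ Finset.univ.image s, s(u, v) ∈ ω) =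
          (Finset.univ.filter fun i => (t i).1 = true).image p ∪ (Finset.univ.filter fun i => (t i).2 = true).image p'} =
      ∏ i, ((if (t i).1 then (w s(s i, p i) : ℝ) else 1 - w s(s i, p i)) *
        (if (t i).2 then (w s(s i, p' i) : ℝ) else 1 - w s(s i, p' i))) := by
  haveI : IsProbabilityMeasure (prodBernoulli w) := inferInstance
  set μ := prodBernoulli w with hμ
  -- the junk pairs at the stars and their null event
  set J : Finset (Sym2 (Fin n)) :=
    (((Finset.univ : Finset (Fin m)) ×ˢ (Finset.univ : Finset (Fin n))).filter
      fun q => q.2 ≠ s q.1 ∧ q.2 ≠ p q.1 ∧ q.2 ≠ p' q.1).image fun q => s(s q.1, q.2) with hJ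
  set N : Set (BondConfig (Fin n)) := {ω | ∃ e ∈ J, e ∈ ω} with hN
  have hN0 : μ N = 0 := by
    have hle : μ.real N ≤ 0 := by
      refine le_trans (prodBernoulli_real_exists_mem_le_sum w J) (le_of_eq (Finset.sum_eq_zero fun e he => ?_))
      rw [hJ, Finset.mem_image] at he
      obtain ⟨q, hq, rfl⟩ := he
      rw [Finset.mem_filter] at hq
      rw [hwjunk q.1 q.2 hq.2.1 hq.2.2.1 hq.2.2.2]
      rfl
    have h0 : μ.real N = 0 := le_antisymm hle measureReal_nonneg
    exact (measureReal_eq_zero_iff (measure_ne_top _ _)).1 h0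
  have hjunk : ∀ ω : BondConfig (Fin n), ω ∉ N → ∀ i u, u ≠ s i → s(s i, u) ∈ ω → u = p i ∨ u = p' i := by
    intro ω hω i u hu he
    by_contra hc
    push Not at hc
    refine hω ⟨s(s i, u), ?_, he⟩
    rw [hJ, Finset.mem_image]
    exact ⟨(i, u), Finset.mem_filter.2 ⟨Finset.mem_product.2 ⟨Finset.mem_univ _, Finset.mem_univ _⟩, hu, hc.1, hc.2⟩, rfl⟩
  -- the class is, off `N`, the cylinder event of the state `t`
  set C : Fin m → Set (BondConfig (Fin n)) :=
    fun i => {ω | (s(s i, p i) ∈ ω ↔ (t i).1 = true) ∧ (s(s i, p' i) ∈ ω ↔ (t i).2 = true)} with hC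
  have hagree : μ.real {ω : BondConfig (Fin n) |
      (Finset.univ.filter fun u => u ∉ Finset.univ.image s ∧ ∃ v ∈ Finset.univ.image s, s(u, v) ∈ ω) =
        (Finset.univ.filter fun i => (t i).1 = true).image p ∪ (Finset.univ.filter fun i => (t i).2 = true).image p'} =
      μ.real (Set.univ ∩ ⋂ i ∈ (Finset.univ : Finset (Fin m)), C i) := by
    apply measureReal_congr
    have key : ∀ ω : BondConfig (Fin n), ω ∉ N →
        ((Finset.univ.filter fun u => u ∉ Finset.univ.image s ∧ ∃ v ∈ Finset.univ.image s, s(u, v) ∈ ω) =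
          (Finset.univ.filter fun i => (t i).1 = true).image p ∪ (Finset.univ.filter fun i => (t i).2 = true).image p' ↔
        ω ∈ Set.univ ∩ ⋂ i ∈ (Finset.univ : Finset (Fin m)), C i) := by
      intro ω hω
      set tω : Fin m → Bool × Bool := fun i => (decide (s(s i, p i) ∈ ω), decide (s(s i, p' i) ∈ ω)) with htω
      have htω' : ∀ i, ((tω i).1 = true ↔ s(s i, p i) ∈ ω) ∧ ((tω i).2 = true ↔ s(s i, p' i) ∈ ω) := fun i => by
        simp only [htω, decide_eq_true_eq, and_self]
      rw [gateSet_eq_portSet ω s p p' tω hps hp's (hjunk ω hω) htω']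
      simp only [mem_inter_iff, mem_univ, true_and, mem_iInter, Finset.mem_univ, forall_true_left, hC, mem_setOf_eq]
      constructor
      · intro h i
        have := congrFun (portSet_injective p p' hpp' hdis tω t h) i
        rw [← this]
        exact ⟨(htω' i).1.symm, (htω' i).2.symm⟩
      · intro h
        have : tω = t := by
          funext i
          refine Prod.ext ?_ ?_
          · rw [Bool.eq_iff_iff, (htω' i).1, (h i).1]
          · rw [Bool.eq_iff_iff, (htω' i).2, (h i).2]
        rw [this]
    refine ae_eq_set.2 ⟨measure_mono_null (fun ω hω => ?_) hN0, measure_mono_null (fun ω hω => ?_) hN0⟩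
    · by_contra hZ; exact hω.2 ((key ω hZ).1 hω.1)
    · by_contra hZ; exact hω.2 ((key ω hZ).2 hω.1)
  rw [hagree]
  -- independence of the star pairs
  have hne : ∀ i, (s(s i, p i) : Sym2 (Fin n)) ≠ s(s i, p' i) := fun i h => hpp' i (Sym2.congr_right.1 h)
  have hSdisj : (↑(Finset.univ : Finset (Fin m)) : Set (Fin m)).PairwiseDisjoint
      fun i => ({s(s i, p i), s(s i, p' i)} : Finset (Sym2 (Fin n))) := by
    intro i _ k _ hik
    rw [Function.onFun, Finset.disjoint_left]
    intro e hei hek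
    simp only [Finset.mem_insert, Finset.mem_singleton] at hei hek
    have hsik : s i ≠ s k := fun h => hik (hs h)
    have aux : ∀ (x y : Fin n), (s(s i, x) : Sym2 (Fin n)) = s(s k, y) → (∀ l, y ≠ s l) → False := by
      intro x y h hy
      rcases Sym2.eq_iff.1 h with ⟨h1, _⟩ | ⟨h1, _⟩
      · exact hsik h1
      · exact hy i h1.symm
    rcases hei with rfl | rfl <;> rcases hek with h | h
    · exact aux _ _ h (fun l => hps k l)
    · exact aux _ _ h (fun l => hp's k l)
    · exact aux _ _ h (fun l => hps k l)
    · exact aux _ _ h (fun l => hp's k l)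
  have hCdet : ∀ i ∈ (Finset.univ : Finset (Fin m)),
      DeterminedBy (C i) (↑({s(s i, p i), s(s i, p' i)} : Finset (Sym2 (Fin n))) : Set (Sym2 (Fin n))) := by
    intro i _
    rw [determinedBy_iff]
    intro ω ω' hωω'
    have key : ∀ e ∈ ({s(s i, p i), s(s i, p' i)} : Finset (Sym2 (Fin n))), (e ∈ ω ↔ e ∈ ω') := by
      intro e he
      have := Set.ext_iff.1 hωω' e
      simp only [mem_inter_iff, Finset.mem_coe, he, and_true] at this
      exact this
    simp only [hC, mem_setOf_eq]
    rw [key _ (by simp), key _ (by simp)]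
  have hprod := prodBernoulli_real_inter_biInter_of_determinedBy w (Finset.univ : Finset (Fin m))
    (fun i => ({s(s i, p i), s(s i, p' i)} : Finset (Sym2 (Fin n)))) hSdisj hCdet
    (fun i _ => MeasurableSet.of_discrete) (A := Set.univ) (determinedBy_univ _) MeasurableSet.univ
  rw [hprod, probReal_univ, one_mul]
  refine Finset.prod_congr rfl fun i _ => ?_
  -- one star: the two port pairs are independent
  have hsplit : C i = {ω | s(s i, p i) ∈ ω ↔ (t i).1 = true} ∩ {ω | s(s i, p' i) ∈ ω ↔ (t i).2 = true} := by
    ext ω; simp only [hC, mem_setOf_eq, mem_inter_iff]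
  have hdet1 : DeterminedBy {ω : BondConfig (Fin n) | s(s i, p i) ∈ ω ↔ (t i).1 = true}
      (↑({s(s i, p i)} : Finset (Sym2 (Fin n))) : Set (Sym2 (Fin n))) := by
    rw [determinedBy_iff]
    intro ω ω' hωω'
    have := Set.ext_iff.1 hωω' s(s i, p i)
    simp only [mem_inter_iff, Finset.coe_singleton, mem_singleton_iff, and_true] at this
    simp only [mem_setOf_eq, this]
  have hdet2 : DeterminedBy {ω : BondConfig (Fin n) | s(s i, p' i) ∈ ω ↔ (t i).2 = true}
      (↑({s(s i, p' i)} : Finset (Sym2 (Fin n))) : Set (Sym2 (Fin n))) := by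
    rw [determinedBy_iff]
    intro ω ω' hωω'
    have := Set.ext_iff.1 hωω' s(s i, p' i)
    simp only [mem_inter_iff, Finset.coe_singleton, mem_singleton_iff, and_true] at this
    simp only [mem_setOf_eq, this]
  have hdisj1 : Disjoint ({s(s i, p i)} : Finset (Sym2 (Fin n))) {s(s i, p' i)} := by
    rw [Finset.disjoint_singleton]; exact hne i
  rw [hsplit, prodBernoulli_real_inter_of_determinedBy_disjoint w hdisj1 hdet1 hdet2 MeasurableSet.of_discrete
    MeasurableSet.of_discrete]
  have hone : ∀ (e : Sym2 (Fin n)) (b : Bool), μ.real {ω : BondConfig (Fin n) | e ∈ ω ↔ b = true} =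
      if b then (w e : ℝ) else 1 - w e := by
    intro e b
    cases b
    · simp only [Bool.false_eq_true, iff_false, if_false]
      exact prodBernoulli_real_setOf_notMem w e
    · simp only [iff_true, if_true]
      exact prodBernoulli_real_setOf_mem w e
  rw [hone, hone]

/-- **Gate expansion of the separated margin of a two-port star family (step (1), any number of stars).**
`μ_w(c ↮ S, |π(c)| ≤ j) − μ_w(c ↮ S, 1 ≤ |π(S)| ≤ j) = Σ_t ι(t)·[μ_w(c ↮' Y(t), |π'(c)| ≤ j) − μ_w(c ↮' Y(t), 1 ≤ |π'(Y(t))| ≤ j)]`,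
primes read on `ξ(ω) = ω ∩ {e | ∀ v ∈ S, v ∉ e}`, `S = {s i}`. [folklore] -/
theorem setCSdiff_gate_expansion (w : Sym2 (Fin n) → unitInterval) (A : Finset (Fin n)) (s p p' : Fin m → Fin n) (c : Fin n)
    (j : ℕ) (hs : Function.Injective s) (hsA : ∀ i, s i ∉ A) (hps : ∀ i k, p i ≠ s k) (hp's : ∀ i k, p' i ≠ s k)
    (hpp' : ∀ i, p i ≠ p' i) (hdis : ∀ i k, i ≠ k → p i ≠ p k ∧ p i ≠ p' k ∧ p' i ≠ p' k) (hcs : ∀ i, c ≠ s i)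
    (hwjunk : ∀ i u, u ≠ s i → u ≠ p i → u ≠ p' i → w s(s i, u) = 0) :
    (prodBernoulli w).real {ω : BondConfig (Fin n) | (∀ x ∈ Finset.univ.image s, ω ∉ openConn c x) ∧
        (A.filter fun z => ω ∈ openConn c z).card ≤ j} -
      (prodBernoulli w).real {ω : BondConfig (Fin n) | (∀ x ∈ Finset.univ.image s, ω ∉ openConn c x) ∧
        1 ≤ (A.filter fun z => ∃ x ∈ Finset.univ.image s, ω ∈ openConn x z).card ∧
        (A.filter fun z => ∃ x ∈ Finset.univ.image s, ω ∈ openConn x z).card ≤ j} =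
    ∑ t : Fin m → Bool × Bool,
      (∏ i, ((if (t i).1 then (w s(s i, p i) : ℝ) else 1 - w s(s i, p i)) *
        (if (t i).2 then (w s(s i, p' i) : ℝ) else 1 - w s(s i, p' i)))) *
      ((prodBernoulli w).real {ω : BondConfig (Fin n) |
          (∀ u ∈ (Finset.univ.filter fun i => (t i).1 = true).image p ∪ (Finset.univ.filter fun i => (t i).2 = true).image p',
            ¬ (openGraph (ω ∩ {e | ∀ v ∈ Finset.univ.image s, v ∉ e})).Reachable c u) ∧
          (A.filter fun z => (openGraph (ω ∩ {e | ∀ v ∈ Finset.univ.image s, v ∉ e})).Reachable c z).card ≤ j} -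
        (prodBernoulli w).real {ω : BondConfig (Fin n) |
          (∀ u ∈ (Finset.univ.filter fun i => (t i).1 = true).image p ∪ (Finset.univ.filter fun i => (t i).2 = true).image p',
            ¬ (openGraph (ω ∩ {e | ∀ v ∈ Finset.univ.image s, v ∉ e})).Reachable c u) ∧
          1 ≤ (A.filter fun z => ∃ u ∈ (Finset.univ.filter fun i => (t i).1 = true).image p ∪
              (Finset.univ.filter fun i => (t i).2 = true).image p',
            (openGraph (ω ∩ {e | ∀ v ∈ Finset.univ.image s, v ∉ e})).Reachable u z).card ∧
          (A.filter fun z => ∃ u ∈ (Finset.univ.filter fun i => (t i).1 = true).image p ∪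
              (Finset.univ.filter fun i => (t i).2 = true).image p',
            (openGraph (ω ∩ {e | ∀ v ∈ Finset.univ.image s, v ∉ e})).Reachable u z).card ≤ j}) := by
  haveI : IsProbabilityMeasure (prodBernoulli w) := inferInstance
  set μ := prodBernoulli w with hμ
  set Yof : (Fin m → Bool × Bool) → Finset (Fin n) := fun t =>
    (Finset.univ.filter fun i => (t i).1 = true).image p ∪ (Finset.univ.filter fun i => (t i).2 = true).image p' with hYof
  set 𝒴 : Finset (Finset (Fin n)) := Finset.univ.image Yof with h𝒴
  -- the gate set is a port set almost surely
  have h𝒴null : μ.real {ω : BondConfig (Fin n) |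
      (Finset.univ.filter fun u => u ∉ Finset.univ.image s ∧ ∃ v ∈ Finset.univ.image s, s(u, v) ∈ ω) ∉ 𝒴} = 0 := by
    set J : Finset (Sym2 (Fin n)) :=
      (((Finset.univ : Finset (Fin m)) ×ˢ (Finset.univ : Finset (Fin n))).filter
        fun q => q.2 ≠ s q.1 ∧ q.2 ≠ p q.1 ∧ q.2 ≠ p' q.1).image fun q => s(s q.1, q.2) with hJ
    have hsub : {ω : BondConfig (Fin n) |
        (Finset.univ.filter fun u => u ∉ Finset.univ.image s ∧ ∃ v ∈ Finset.univ.image s, s(u, v) ∈ ω) ∉ 𝒴} ⊆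
        {ω | ∃ e ∈ J, e ∈ ω} := by
      intro ω hω
      by_contra hN
      apply hω
      have hjunk : ∀ i u, u ≠ s i → s(s i, u) ∈ ω → u = p i ∨ u = p' i := by
        intro i u hu he
        by_contra hc
        push Not at hc
        refine hN ⟨s(s i, u), ?_, he⟩
        rw [hJ, Finset.mem_image]
        exact ⟨(i, u), Finset.mem_filter.2 ⟨Finset.mem_product.2 ⟨Finset.mem_univ _, Finset.mem_univ _⟩, hu, hc.1, hc.2⟩, rfl⟩
      set tω : Fin m → Bool × Bool := fun i => (decide (s(s i, p i) ∈ ω), decide (s(s i, p' i) ∈ ω)) with htω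
      have htω' : ∀ i, ((tω i).1 = true ↔ s(s i, p i) ∈ ω) ∧ ((tω i).2 = true ↔ s(s i, p' i) ∈ ω) := fun i => by
        simp only [htω, decide_eq_true_eq, and_self]
      rw [gateSet_eq_portSet ω s p p' tω hps hp's hjunk htω', h𝒴, Finset.mem_image]
      exact ⟨tω, Finset.mem_univ _, rfl⟩
    refine le_antisymm (le_trans (measureReal_mono hsub) ?_) measureReal_nonneg
    refine le_trans (prodBernoulli_real_exists_mem_le_sum w J) (le_of_eq (Finset.sum_eq_zero fun e he => ?_))
    rw [hJ, Finset.mem_image] at he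
    obtain ⟨q, hq, rfl⟩ := he
    rw [Finset.mem_filter] at hq
    rw [hwjunk q.1 q.2 hq.2.1 hq.2.2.1 hq.2.2.2]
    rfl
  have hSA : Disjoint (Finset.univ.image s) A := by
    rw [Finset.disjoint_left]
    intro x hx
    rw [Finset.mem_image] at hx
    obtain ⟨i, -, rfl⟩ := hx
    exact hsA i
  have hcS : c ∉ Finset.univ.image s := by
    rw [Finset.mem_image]; rintro ⟨i, -, hi⟩; exact hcs i hi.symm
  rw [CutObserver.SetStar.setR_eq_sum w A (Finset.univ.image s) c j hcS 𝒴 h𝒴null,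
    CutObserver.SetStar.setL_eq_sum w A (Finset.univ.image s) c j hSA hcS 𝒴 h𝒴null, ← Finset.sum_sub_distrib]
  have hinj : ∀ t ∈ (Finset.univ : Finset (Fin m → Bool × Bool)), ∀ t' ∈ (Finset.univ : Finset (Fin m → Bool × Bool)),
      Yof t = Yof t' → t = t' := fun t _ t' _ h => portSet_injective p p' hpp' hdis t t' h
  rw [h𝒴, Finset.sum_image hinj]
  refine Finset.sum_congr rfl fun t _ => ?_
  rw [← mul_sub]
  congr 1
  exact real_gateSet_eq_stateWeight w s p p' t hs hps hp's hpp' hdis hwjunk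

end StarSet

end Summit.CriticalPhenomena.PercolationContinuityZ3.Theorems

end
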